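import Mathlib
import Summits.ValiantsHypothesis.ValiantsHypothesis.Theorems.RigidityForcesSymmetryRankRigidMinimalReprLaplaceFiveSectorSplitDefs
import Summits.ValiantsHypothesis.ValiantsHypothesis.Theorems.RigidityForcesSymmetryRankRigidMinimalReprLaplaceFiveSectorSplit
import Summits.ValiantsHypothesis.ValiantsHypothesis.Theorems.RigidityForcesSymmetryRankRigidMinimalReprLaplaceFiveTriangleSeparation

/-!
# ValiantsHypothesis / RigidityForcesSymmetry — crux `LaplaceOptimalFive` (stmt-ValiantsHypothesis-24813), crux idea
`young-shadow` (K1): THREE-SPLIT SEPARATION for the three NON-TRIANGLE orbit types, at normalized slots.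

Three distinct pair splits of `Fin 5` form one of four graphs: triangle (`…LaplaceFiveTriangleSeparation`), star
`K₁,₃`, path `P₄`, or `P₃ ⊔ K₂`.  For the last three one of the shadows picks up, from the full symmetry of the sum, the
transpositions lying in the Young groups of BOTH other splits, which together with its own Young group connect all
five slots; so that shadow is fully symmetric, and the remaining two separate by ✓ `LaplaceFiveSectorSplit.twoSplit_separation`.
Statements use the ported vocabulary `LaplaceFiveSectorSplit.SlotInvariantOn` (✓ `…SectorSplitDefs`), i.e. they are the
sketch's `stub_threeSplit_separation` at the instances `({0,1},{0,2},{0,3})`, `({0,1},{1,2},{2,3})`, `({0,1},{1,2},{3,4})`.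

Honest framing.  Normalized representatives only (the transport to arbitrary slot labels is not in this file); K1
`SideSymLaplaceOptimalFive`, `LaplaceOptimalFive` (OPEN · CONTESTED 72/120), `RankRigidMinimalRepr`, `VP ≠ VNP` NOT proved.
No definitions, no `sorry`; Mathlib + tree only.
-/

set_option linter.dupNamespace false

namespace Summit.ValiantsHypothesis.ValiantsHypothesis.Theorems.RigidityForcesSymmetryRankRigidMinimalRepr

namespace LaplaceFiveThreeSplitTypes

open Finset LaplaceFiveSectorSplit
open LaplaceFiveTriangleSeparation (inv_mul)

/-- Swap invariance read off a `SlotInvariantOn` hypothesis. [folklore] -/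
theorem swap_inv (P : Finset (Fin 5)) (Z : (Fin 5 → Fin 5) → ℂ) (h : SlotInvariantOn P Z) {a b : Fin 5}
    (ha : a ∈ P) (hb : b ∈ P) : ∀ v : Fin 5 → Fin 5, Z (v ∘ ⇑(Equiv.swap a b)) = Z v :=
  h (Equiv.swap a b) fun _ hi => Equiv.swap_apply_of_ne_of_ne (fun e => hi (e ▸ ha)) (fun e => hi (e ▸ hb))

/-- Invariance under the adjacent transpositions `(0 1), (1 2), (2 3), (3 4)` is full slot symmetry. [folklore] -/
theorem full_of_adjacent_swaps (Z : (Fin 5 → Fin 5) → ℂ)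
    (h01 : ∀ v : Fin 5 → Fin 5, Z (v ∘ ⇑(Equiv.swap (0 : Fin 5) 1)) = Z v)
    (h12 : ∀ v : Fin 5 → Fin 5, Z (v ∘ ⇑(Equiv.swap (1 : Fin 5) 2)) = Z v)
    (h23 : ∀ v : Fin 5 → Fin 5, Z (v ∘ ⇑(Equiv.swap (2 : Fin 5) 3)) = Z v)
    (h34 : ∀ v : Fin 5 → Fin 5, Z (v ∘ ⇑(Equiv.swap (3 : Fin 5) 4)) = Z v) :
    SlotInvariantOn Finset.univ Z := by
  have h02 : ∀ v : Fin 5 → Fin 5, Z (v ∘ ⇑(Equiv.swap (0 : Fin 5) 2)) = Z v := by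
    rw [show Equiv.swap (0 : Fin 5) 2 = Equiv.swap 1 2 * Equiv.swap 0 1 * Equiv.swap 1 2 from by decide]
    exact inv_mul Z (inv_mul Z h12 h01) h12
  have h13 : ∀ v : Fin 5 → Fin 5, Z (v ∘ ⇑(Equiv.swap (1 : Fin 5) 3)) = Z v := by
    rw [show Equiv.swap (1 : Fin 5) 3 = Equiv.swap 2 3 * Equiv.swap 1 2 * Equiv.swap 2 3 from by decide]
    exact inv_mul Z (inv_mul Z h23 h12) h23
  have h24 : ∀ v : Fin 5 → Fin 5, Z (v ∘ ⇑(Equiv.swap (2 : Fin 5) 4)) = Z v := by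
    rw [show Equiv.swap (2 : Fin 5) 4 = Equiv.swap 3 4 * Equiv.swap 2 3 * Equiv.swap 3 4 from by decide]
    exact inv_mul Z (inv_mul Z h34 h23) h34
  have h03 : ∀ v : Fin 5 → Fin 5, Z (v ∘ ⇑(Equiv.swap (0 : Fin 5) 3)) = Z v := by
    rw [show Equiv.swap (0 : Fin 5) 3 = Equiv.swap 2 3 * Equiv.swap 0 2 * Equiv.swap 2 3 from by decide]
    exact inv_mul Z (inv_mul Z h23 h02) h23
  have h14 : ∀ v : Fin 5 → Fin 5, Z (v ∘ ⇑(Equiv.swap (1 : Fin 5) 4)) = Z v := by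
    rw [show Equiv.swap (1 : Fin 5) 4 = Equiv.swap 3 4 * Equiv.swap 1 3 * Equiv.swap 3 4 from by decide]
    exact inv_mul Z (inv_mul Z h34 h13) h34
  have h04 : ∀ v : Fin 5 → Fin 5, Z (v ∘ ⇑(Equiv.swap (0 : Fin 5) 4)) = Z v := by
    rw [show Equiv.swap (0 : Fin 5) 4 = Equiv.swap 3 4 * Equiv.swap 0 3 * Equiv.swap 3 4 from by decide]
    exact inv_mul Z (inv_mul Z h34 h03) h34
  have hall : ∀ x y : Fin 5, x ≠ y → ∀ v : Fin 5 → Fin 5, Z (v ∘ ⇑(Equiv.swap x y)) = Z v := by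
    intro x y hxy
    fin_cases x <;> fin_cases y
    all_goals first
      | exact absurd rfl hxy
      | exact h01 | exact h02 | exact h03 | exact h04 | exact h12 | exact h13 | exact h14 | exact h23 | exact h24
      | exact h34
      | (rw [Equiv.swap_comm]; first
          | exact h01 | exact h02 | exact h03 | exact h04 | exact h12 | exact h13 | exact h14 | exact h23
          | exact h24 | exact h34)
  have key : ∀ τ : Equiv.Perm (Fin 5), ∀ v : Fin 5 → Fin 5, Z (v ∘ ⇑τ) = Z v := by
    intro τ
    induction τ using Equiv.Perm.swap_induction_on with
    | one => intro v; simp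
    | swap_mul f x y hxy ih => exact inv_mul Z (hall x y hxy) ih
  exact fun τ _ v => key τ v

/-- A fully symmetric sum minus a fully symmetric summand is fully symmetric. [folklore] -/
theorem rest_full {Z₁ Z₂ Z₃ : (Fin 5 → Fin 5) → ℂ} (hsum : SlotInvariantOn Finset.univ (Z₁ + Z₂ + Z₃))
    (h₁ : SlotInvariantOn Finset.univ Z₁) : SlotInvariantOn Finset.univ (Z₂ + Z₃) := by
  intro τ hτ v
  have hs := hsum τ hτ v
  have h1 := h₁ τ hτ v
  simp only [Pi.add_apply] at hs ⊢
  linear_combination hs - h1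

/-- **Star type** `{0,1}, {0,2}, {0,3}`: three-split separation. [folklore] -/
theorem threeSplit_separation_star (Z₁ Z₂ Z₃ : (Fin 5 → Fin 5) → ℂ)
    (hZ₁ : SlotInvariantOn {0, 1} Z₁ ∧ SlotInvariantOn {0, 1}ᶜ Z₁)
    (hZ₂ : SlotInvariantOn {0, 2} Z₂ ∧ SlotInvariantOn {0, 2}ᶜ Z₂)
    (hZ₃ : SlotInvariantOn {0, 3} Z₃ ∧ SlotInvariantOn {0, 3}ᶜ Z₃)
    (hsum : SlotInvariantOn Finset.univ (Z₁ + Z₂ + Z₃)) :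
    SlotInvariantOn Finset.univ Z₁ ∧ SlotInvariantOn Finset.univ Z₂ ∧ SlotInvariantOn Finset.univ Z₃ := by
  have a01 := swap_inv _ _ hZ₁.1 (a := 0) (b := 1) (by decide) (by decide)
  have a23 := swap_inv _ _ hZ₁.2 (a := 2) (b := 3) (by decide) (by decide)
  have a24 := swap_inv _ _ hZ₁.2 (a := 2) (b := 4) (by decide) (by decide)
  have a34 := swap_inv _ _ hZ₁.2 (a := 3) (b := 4) (by decide) (by decide)
  have b14 := swap_inv _ _ hZ₂.2 (a := 1) (b := 4) (by decide) (by decide)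
  have c14 := swap_inv _ _ hZ₃.2 (a := 1) (b := 4) (by decide) (by decide)
  -- `(1 4)` lies in both other Young groups, so `Z₁` inherits it from the symmetric sum
  have a14 : ∀ v : Fin 5 → Fin 5, Z₁ (v ∘ ⇑(Equiv.swap (1 : Fin 5) 4)) = Z₁ v := by
    intro v
    have hs := hsum (Equiv.swap 1 4) (fun i hi => absurd (Finset.mem_univ i) hi) v
    simp only [Pi.add_apply] at hs
    rw [b14 v, c14 v] at hs
    linear_combination hs
  have a12 : ∀ v : Fin 5 → Fin 5, Z₁ (v ∘ ⇑(Equiv.swap (1 : Fin 5) 2)) = Z₁ v := by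
    rw [show Equiv.swap (1 : Fin 5) 2 = Equiv.swap 2 4 * Equiv.swap 1 4 * Equiv.swap 2 4 from by decide]
    exact inv_mul Z₁ (inv_mul Z₁ a24 a14) a24
  have h₁ := full_of_adjacent_swaps Z₁ a01 a12 a23 a34
  have h23 := twoSplit_separation {0, 2} {0, 3} (by decide) (by decide) (by decide) Z₂ Z₃ hZ₂ hZ₃ (rest_full hsum h₁)
  exact ⟨h₁, h23.1, h23.2⟩

/-- **Path type** `{0,1}, {1,2}, {2,3}`: three-split separation. [folklore] -/
theorem threeSplit_separation_path (Z₁ Z₂ Z₃ : (Fin 5 → Fin 5) → ℂ)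
    (hZ₁ : SlotInvariantOn {0, 1} Z₁ ∧ SlotInvariantOn {0, 1}ᶜ Z₁)
    (hZ₂ : SlotInvariantOn {1, 2} Z₂ ∧ SlotInvariantOn {1, 2}ᶜ Z₂)
    (hZ₃ : SlotInvariantOn {2, 3} Z₃ ∧ SlotInvariantOn {2, 3}ᶜ Z₃)
    (hsum : SlotInvariantOn Finset.univ (Z₁ + Z₂ + Z₃)) :
    SlotInvariantOn Finset.univ Z₁ ∧ SlotInvariantOn Finset.univ Z₂ ∧ SlotInvariantOn Finset.univ Z₃ := by
  have b12 := swap_inv _ _ hZ₂.1 (a := 1) (b := 2) (by decide) (by decide)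
  have b34 := swap_inv _ _ hZ₂.2 (a := 3) (b := 4) (by decide) (by decide)
  have a01 := swap_inv _ _ hZ₁.1 (a := 0) (b := 1) (by decide) (by decide)
  have a23 := swap_inv _ _ hZ₁.2 (a := 2) (b := 3) (by decide) (by decide)
  have c01 := swap_inv _ _ hZ₃.2 (a := 0) (b := 1) (by decide) (by decide)
  have c23 := swap_inv _ _ hZ₃.1 (a := 2) (b := 3) (by decide) (by decide)
  -- the middle shadow inherits `(0 1)` and `(2 3)` from the symmetric sum
  have b01 : ∀ v : Fin 5 → Fin 5, Z₂ (v ∘ ⇑(Equiv.swap (0 : Fin 5) 1)) = Z₂ v := by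
    intro v
    have hs := hsum (Equiv.swap 0 1) (fun i hi => absurd (Finset.mem_univ i) hi) v
    simp only [Pi.add_apply] at hs
    rw [a01 v, c01 v] at hs
    linear_combination hs
  have b23 : ∀ v : Fin 5 → Fin 5, Z₂ (v ∘ ⇑(Equiv.swap (2 : Fin 5) 3)) = Z₂ v := by
    intro v
    have hs := hsum (Equiv.swap 2 3) (fun i hi => absurd (Finset.mem_univ i) hi) v
    simp only [Pi.add_apply] at hs
    rw [a23 v, c23 v] at hs
    linear_combination hs
  have h₂ := full_of_adjacent_swaps Z₂ b01 b12 b23 b34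
  have hsum' : SlotInvariantOn Finset.univ (Z₂ + Z₁ + Z₃) := by
    intro τ hτ v
    have := hsum τ hτ v
    simp only [Pi.add_apply] at this ⊢
    linear_combination this
  have h13 := twoSplit_separation {0, 1} {2, 3} (by decide) (by decide) (by decide) Z₁ Z₃ hZ₁ hZ₃ (rest_full hsum' h₂)
  exact ⟨h13.1, h₂, h13.2⟩

/-- **Type `P₃ ⊔ K₂`** `{0,1}, {1,2}, {3,4}`: three-split separation. [folklore] -/
theorem threeSplit_separation_pathEdge (Z₁ Z₂ Z₃ : (Fin 5 → Fin 5) → ℂ)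
    (hZ₁ : SlotInvariantOn {0, 1} Z₁ ∧ SlotInvariantOn {0, 1}ᶜ Z₁)
    (hZ₂ : SlotInvariantOn {1, 2} Z₂ ∧ SlotInvariantOn {1, 2}ᶜ Z₂)
    (hZ₃ : SlotInvariantOn {3, 4} Z₃ ∧ SlotInvariantOn {3, 4}ᶜ Z₃)
    (hsum : SlotInvariantOn Finset.univ (Z₁ + Z₂ + Z₃)) :
    SlotInvariantOn Finset.univ Z₁ ∧ SlotInvariantOn Finset.univ Z₂ ∧ SlotInvariantOn Finset.univ Z₃ := by
  have a01 := swap_inv _ _ hZ₁.1 (a := 0) (b := 1) (by decide) (by decide)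
  have a23 := swap_inv _ _ hZ₁.2 (a := 2) (b := 3) (by decide) (by decide)
  have a34 := swap_inv _ _ hZ₁.2 (a := 3) (b := 4) (by decide) (by decide)
  have b12 := swap_inv _ _ hZ₂.1 (a := 1) (b := 2) (by decide) (by decide)
  have c12 := swap_inv _ _ hZ₃.2 (a := 1) (b := 2) (by decide) (by decide)
  -- `Z₁` inherits `(1 2)` from the symmetric sum
  have a12 : ∀ v : Fin 5 → Fin 5, Z₁ (v ∘ ⇑(Equiv.swap (1 : Fin 5) 2)) = Z₁ v := by
    intro v
    have hs := hsum (Equiv.swap 1 2) (fun i hi => absurd (Finset.mem_univ i) hi) v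
    simp only [Pi.add_apply] at hs
    rw [b12 v, c12 v] at hs
    linear_combination hs
  have h₁ := full_of_adjacent_swaps Z₁ a01 a12 a23 a34
  have h23 := twoSplit_separation {1, 2} {3, 4} (by decide) (by decide) (by decide) Z₂ Z₃ hZ₂ hZ₃ (rest_full hsum h₁)
  exact ⟨h₁, h23.1, h23.2⟩

end LaplaceFiveThreeSplitTypes

end Summit.ValiantsHypothesis.ValiantsHypothesis.Theorems.RigidityForcesSymmetryRankRigidMinimalRepr
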